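import Summits.QuantumFields.YangMills.Theorems.BalabanLadderIRReflectedAntipodalCofinalSc
import HarnessLib

/-!
# Crux `BalabanLadder.IRcof` (stmt-QuantumFields-26930): the cofinal leaf is a statement about a SEQUENCE of couplings `β_k → ∞`
# (equivalence helper; LEAD prover ym-ir-line-ab-p1 gen 6, slot custody)

HONEST STATUS.  Pure bookkeeping (choice + monotonicity of `GapOn` in the coupling set); nothing here proves `BalabanLadder.IRcof` (26930),
`BalabanLadder.IR` (19354), any lattice mass gap, or the Clay Yang–Mills problem (R4 = the conditional finite-𝕋⁴ rung `BalabanLadder.UV` only).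

The re-typed leaf `IRcof` (R423 ∕ R424 (a)) asks the `GapInUnits` clustering family on SOME coupling set `Bset` that is unbounded above
(`∀ x, ∃ β ∈ Bset, x ≤ β`); the route's `closes` then re-runs the OS bridge along couplings chosen inside `Bset`
(`Y2Bridge.yangMills_of_cofinalLegs`).  THIS FILE records the equivalent SEQUENTIAL typing, which is how a lattice continuum limit is
usually phrased (a scheme `β_k → ∞`): `IRcofSeq` — «… → ∃ b : ℕ → ℝ, b_k → ∞ ∧ GapOn G r a (range b)» — and
`IRcof_iff_seq : Theses.BalabanLadder.IRcof ↔ IRcofSeq` (cofinal set ↦ choose `b_k ∈ Bset` with `k ≤ b_k`, restrict by `gapOn_mono`;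
sequence ↦ its range is cofinal).  The same for the registered nsc stub: `IRnscCof_iff_seq`, and for `IRscCof`.  `GapOn`, `gapOn_mono` are
idea-14's ∕ the LEAD's landed names (`BalabanLadderIRReflectedAntipodalCofinal{,Sc}`).
-/

open MeasureTheory Filter Topology
open Literature.MathematicalPhysics.QuantumFieldTheory Literature.MathematicalPhysics.QuantumLattice
open Summit.QuantumFields.YangMills.Cruxes.OSLegsFromFemtoAndGap.DlrCollarTransfer (LowerBounds)
open Summit.QuantumFields.YangMills.Cruxes.IR.RankPurity (IRscCof IRnscCof)

noncomputable section

namespace Summit.QuantumFields.YangMills.Cruxes.IR.ReflectedAntipodal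

variable {G : Type} [Group G] [TopologicalSpace G] [IsTopologicalGroup G] [CompactSpace G]
  [MeasurableSpace G] [BorelSpace G]

/-! ## §1 Cofinal set ⟺ divergent sequence, for the clustering family `GapOn` -/

section Seq
variable (G) (r : LatticeRep G) (a : ℝ → ℝ)

/-- **From a cofinal coupling set to a divergent sequence**: if `Bset` is unbounded above and carries `GapOn`, some sequence
`b : ℕ → ℝ` with `b_k → ∞` carries `GapOn` on its range (choose `b_k ∈ Bset` with `k ≤ b_k`; `GapOn` is monotone in the set). -/
theorem exists_seq_of_gapOn_cofinal {Bset : Set ℝ} (hcof : ∀ x : ℝ, ∃ β ∈ Bset, x ≤ β) (h : GapOn G r a Bset) :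
    ∃ b : ℕ → ℝ, Tendsto b atTop atTop ∧ GapOn G r a (Set.range b) := by
  choose b hbB hbge using fun k : ℕ => hcof (k : ℝ)
  refine ⟨b, ?_, gapOn_mono G r a (Set.range_subset_iff.2 hbB) h⟩
  exact tendsto_atTop_mono hbge tendsto_natCast_atTop_atTop

/-- **From a divergent sequence to a cofinal coupling set**: the range of `b` with `b_k → ∞` is unbounded above. -/
theorem cofinal_range_of_tendsto {b : ℕ → ℝ} (hb : Tendsto b atTop atTop) : ∀ x : ℝ, ∃ β ∈ Set.range b, x ≤ β := by
  intro x
  obtain ⟨k, hk⟩ := (hb.eventually (eventually_ge_atTop x)).exists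
  exact ⟨b k, Set.mem_range_self k, hk⟩

/-- `GapOn` on a cofinal set ⟺ `GapOn` on the range of a divergent sequence. -/
theorem gapOn_cofinal_iff_seq :
    (∃ Bset : Set ℝ, (∀ x : ℝ, ∃ β ∈ Bset, x ≤ β) ∧ GapOn G r a Bset) ↔
      ∃ b : ℕ → ℝ, Tendsto b atTop atTop ∧ GapOn G r a (Set.range b) := by
  constructor
  · rintro ⟨Bset, hcof, h⟩
    exact exists_seq_of_gapOn_cofinal G r a hcof h
  · rintro ⟨b, hb, h⟩
    exact ⟨Set.range b, cofinal_range_of_tendsto hb, h⟩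

end Seq

/-! ## §2 The leaf and its two π₁-conjuncts in sequential form -/

/-- **`IRcofSeq` — the cofinal leaf typed along a SEQUENCE of couplings**: for every compact simple `G`, every `r`, every positive unit
map `a → 0` carrying the floor, some sequence `b_k → ∞` carries the `GapInUnits` clustering family on its range. -/
def IRcofSeq : Prop :=
  ∀ (G : Type) [Group G] [TopologicalSpace G] [IsTopologicalGroup G] [CompactSpace G],
    IsCompactSimpleLieGroup G →
    letI : MeasurableSpace G := borel G
    haveI : BorelSpace G := ⟨rfl⟩
    ∀ (r : LatticeRep G) (a : ℝ → ℝ), (∀ β, 0 < a β) → Tendsto a atTop (𝓝 0) → LowerBounds G r a →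
      ∃ b : ℕ → ℝ, Tendsto b atTop atTop ∧ GapOn G r a (Set.range b)

/-- **The cofinal leaf `BalabanLadder.IRcof` (stmt-QuantumFields-26930) IS its sequential form** (PROVED equivalence). -/
theorem IRcof_iff_seq : Summit.QuantumFields.YangMills.Theses.BalabanLadder.IRcof ↔ IRcofSeq := by
  constructor
  · intro h G _ _ _ _ hG
    letI : MeasurableSpace G := borel G
    haveI : BorelSpace G := ⟨rfl⟩
    intro r a ha ha0 hlb
    obtain ⟨Bset, hcof, hgap⟩ := h G hG r a ha ha0 hlb
    exact exists_seq_of_gapOn_cofinal G r a hcof hgap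
  · intro h G _ _ _ _ hG
    letI : MeasurableSpace G := borel G
    haveI : BorelSpace G := ⟨rfl⟩
    intro r a ha ha0 hlb
    obtain ⟨b, hb, hgap⟩ := h G hG r a ha ha0 hlb
    exact ⟨Set.range b, cofinal_range_of_tendsto hb, hgap⟩

/-- **The registered nsc stub `RankPurity.IRnscCof` (26930 slot of record) in sequential form** (PROVED equivalence, body spelled with
`GapOn` on the range of a divergent sequence). -/
theorem IRnscCof_iff_seq : IRnscCof ↔
    ∀ (G : Type) [Group G] [TopologicalSpace G] [IsTopologicalGroup G] [CompactSpace G],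
      IsCompactSimpleLieGroup G → ¬ SimplyConnectedSpace G →
      letI : MeasurableSpace G := borel G
      haveI : BorelSpace G := ⟨rfl⟩
      ∀ (r : LatticeRep G) (a : ℝ → ℝ), (∀ β, 0 < a β) → Tendsto a atTop (𝓝 0) → LowerBounds G r a →
        ∃ b : ℕ → ℝ, Tendsto b atTop atTop ∧ GapOn G r a (Set.range b) := by
  constructor
  · intro h G _ _ _ _ hG hns
    letI : MeasurableSpace G := borel G
    haveI : BorelSpace G := ⟨rfl⟩
    intro r a ha ha0 hlb
    obtain ⟨Bset, hcof, hgap⟩ := h G hG hns r a ha ha0 hlb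
    exact exists_seq_of_gapOn_cofinal G r a hcof hgap
  · intro h G _ _ _ _ hG hns
    letI : MeasurableSpace G := borel G
    haveI : BorelSpace G := ⟨rfl⟩
    intro r a ha ha0 hlb
    obtain ⟨b, hb, hgap⟩ := h G hG hns r a ha ha0 hlb
    exact ⟨Set.range b, cofinal_range_of_tendsto hb, hgap⟩

/-- **The simply-connected conjunct `RankPurity.IRscCof` in sequential form** (PROVED equivalence). -/
theorem IRscCof_iff_seq : IRscCof ↔
    ∀ (G : Type) [Group G] [TopologicalSpace G] [IsTopologicalGroup G] [CompactSpace G],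
      IsCompactSimpleLieGroup G → SimplyConnectedSpace G →
      letI : MeasurableSpace G := borel G
      haveI : BorelSpace G := ⟨rfl⟩
      ∀ (r : LatticeRep G) (a : ℝ → ℝ), (∀ β, 0 < a β) → Tendsto a atTop (𝓝 0) → LowerBounds G r a →
        ∃ b : ℕ → ℝ, Tendsto b atTop atTop ∧ GapOn G r a (Set.range b) := by
  constructor
  · intro h G _ _ _ _ hG hsc
    letI : MeasurableSpace G := borel G
    haveI : BorelSpace G := ⟨rfl⟩
    intro r a ha ha0 hlb
    obtain ⟨Bset, hcof, hgap⟩ := h G hG hsc r a ha ha0 hlb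
    exact exists_seq_of_gapOn_cofinal G r a hcof hgap
  · intro h G _ _ _ _ hG hsc
    letI : MeasurableSpace G := borel G
    haveI : BorelSpace G := ⟨rfl⟩
    intro r a ha ha0 hlb
    obtain ⟨b, hb, hgap⟩ := h G hG hsc r a ha ha0 hlb
    exact ⟨Set.range b, cofinal_range_of_tendsto hb, hgap⟩

end Summit.QuantumFields.YangMills.Cruxes.IR.ReflectedAntipodal

end
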